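import Summits.RiemannHypothesis.RiemannHypothesis.Theorems.PfPersistenceM2EvenSectorIndexAccumulation
import HarnessLib

/-!
# PF-persistence, M2 seat (gen 6), part 3/3 (index language): the `K = ∞` residue of the even level-sign
# hierarchy is "real parts accumulate above the line", not "infinitely many off-line zeros"

pub-rhpf cell, M2 seat, generation 6.  HONEST FRAMING: long-odds MECHANISM SEARCH; no RH claims.
Labels: PROVED (kernel) / CITED (Bombieri 2000, Rend. Lincei (9) 11) / HYPOTHESIS (explicit binder).

`EvenNegIndexAtLeast n a` (gen 5): `n` even real-valued Weil tests supported in `[-a, a]` on whose real span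
`Re Q` (`Q = weilQuadratic`, untruncated) is negative definite.  `𝒬` = non-trivial zeros with `Re ρ > 1/2`,
`Im ρ > 0` (`K = #𝒬`); `𝒵_θ` = those with `Re ρ ≥ 1/2 + θ`.  Say the real parts ACCUMULATE ABOVE THE LINE if
`𝒵_θ` is infinite for some `θ > 0` (equivalently: `lim sup Re ρ > 1/2` along the off-line zeros; equivalently the
off-line zeros, if infinitely many, do NOT satisfy `Re ρ → 1/2`).

PROVED here (all RH-free):
* `evenNegIndexAtLeast_of_finite_above` — `𝒵_θ` finite, `n ≤ #𝒵_θ` ⟹ even negative index `≥ n` on all long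
  windows (part 2 repackaged);
* `evenNegIndexAtLeast_zero` — level `0` is trivial;
* `encard_le_or_infinite_above` — THE TRICHOTOMY at level `n`: if NO window carries `n + 1` independent negative
  even directions then EITHER `K ≤ n` OR the real parts accumulate above the line.  Gen 5
  (`quadrant_infinite_or_encard_le`) could only conclude "`K ≤ n` or `K = ∞`"; the undecided configuration is now the
  much thinner "`∃ θ > 0`, infinitely many zeros with `Re ρ ≥ 1/2 + θ`";
* `exists_evenNegIndexAtLeast_iff_of_forall_finite_above` — under the HYPOTHESIS (H_acc) "every `𝒵_θ`, `θ > 0`, is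
  finite" (no accumulation above the line; `K = ∞` allowed): `(∃ a, EvenNegIndexAtLeast n a) ↔ n ≤ K` for EVERY
  `n`, i.e. the negative even index on long windows equals `K ∈ ℕ ∪ {∞}`; in particular
  (`forall_exists_evenNegIndexAtLeast_of_infinite`) `K = ∞` with no accumulation forces UNBOUNDED even index.

READING for the M2 route (proved vs conjectured, as the cell brief demands).  The level-sign hierarchy
"`L_n^{ev}`: no window carries `n+1` negative even directions" is now PROVED equivalent to `K ≤ n` except in ONE typed
configuration: accumulation of real parts above the line.  That configuration is not excluded by anything in
print (zero-density theorems bound `N(σ, T)`, they do not make `𝒵_θ` finite), so the residue is genuine; closing it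
inside this mechanism would need probes whose transforms decay along a vertical line faster than the bystander
count grows (HEURISTIC: Gevrey-class compactly supported tests + a density estimate) — NOT attempted, recorded as
the precise open residue.  Nothing here lowers the strength of the M2 closing input: an `a`-uniform lower bound on
the FIRST even level remains Weil positivity on even tests, i.e. RH-strength. [CITED shape: Bombieri 2000 Thm 9,
even part; Thm 11 and its Corollary for the finite-truncation count.]
-/

noncomputable section

set_option linter.dupNamespace false

open Complex Filter Set MeasureTheory
open scoped Real Topology ComplexConjugate BigOperators

namespace Summit.RiemannHypothesis.RiemannHypothesis.Theorems.PfPersistenceM2NegIndex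

open Literature.NumberTheory.LFunctions
open Literature.NumberTheory.LFunctions.WeilConverse
open Literature.NumberTheory.LFunctions.ZetaZeros

/-! ## H. The trichotomy and the index under "no accumulation above the line" -/

/-- **Lower half, localised** (part 2 repackaged): finitely many zeros with `Re ρ ≥ 1/2 + θ`, `Im ρ > 0`, and
`n ≤` their number ⟹ even negative index `≥ n` on ALL sufficiently long windows.
[cite: Bombieri2000Weil, Thm 9 (even part); Thm 11] -/
theorem evenNegIndexAtLeast_of_finite_above {θ : ℝ} (hθ : 0 < θ)
    (hfin : {ρ : ℂ | ρ ∈ riemannZetaNontrivialZeros ∧ 1 / 2 + θ ≤ ρ.re ∧ 0 < ρ.im}.Finite) {n : ℕ}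
    (hn : n ≤ hfin.toFinset.card) : ∃ A : ℝ, ∀ a : ℝ, A ≤ a → EvenNegIndexAtLeast n a := by
  obtain ⟨A, g, h1, h2, h3, h4, h5⟩ := exists_negative_definite_even_family_of_finite_above hθ hfin hn
  exact ⟨A, fun a ha ↦ EvenNegIndexAtLeast.mono ⟨g, h1, h2, h3, h4, h5⟩ ha⟩

/-- Level `0` is trivial (the empty family). [folklore] -/
theorem evenNegIndexAtLeast_zero (a : ℝ) : EvenNegIndexAtLeast 0 a :=
  ⟨fun i ↦ i.elim0, fun i ↦ i.elim0, fun i ↦ i.elim0, fun i ↦ i.elim0, fun i ↦ i.elim0,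
    fun c hc ↦ absurd (Subsingleton.elim c 0) hc⟩

/-- **THE TRICHOTOMY at level `n` (RH-free, no finiteness hypothesis).**  If no window carries `n + 1` independent
negative even directions, then EITHER there are at most `n` off-line quadruples OR the real parts of the off-line
zeros accumulate above the line: some closed half-plane `Re s ≥ 1/2 + θ`, `θ > 0`, contains infinitely many zeros.
(Gen 5 could only say "`K ≤ n` or `K = ∞`".) [cite: Bombieri2000Weil, Thm 9 (even part); Thm 11] -/
theorem encard_le_or_infinite_above (n : ℕ) (hno : ∀ a : ℝ, ¬ EvenNegIndexAtLeast (n + 1) a) :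
    {ρ : ℂ | ρ ∈ riemannZetaNontrivialZeros ∧ 1 / 2 < ρ.re ∧ 0 < ρ.im}.encard ≤ n ∨
      ∃ θ : ℝ, 0 < θ ∧ {ρ : ℂ | ρ ∈ riemannZetaNontrivialZeros ∧ 1 / 2 + θ ≤ ρ.re ∧ 0 < ρ.im}.Infinite := by
  classical
  rw [or_iff_not_imp_right, not_exists]
  intro hnone
  by_contra hlt
  have hle : (((n + 1 : ℕ)) : ℕ∞) ≤ {ρ : ℂ | ρ ∈ riemannZetaNontrivialZeros ∧ 1 / 2 < ρ.re ∧ 0 < ρ.im}.encard := by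
    rw [not_le] at hlt
    have h := Order.add_one_le_of_lt hlt
    exact_mod_cast h
  obtain ⟨F, hFsub, hFcard⟩ := exists_subset_encard_eq hle
  have hFfin : F.Finite := finite_of_encard_eq_coe hFcard
  have hFne : F.Nonempty := encard_pos.1 (by rw [hFcard]; exact_mod_cast Nat.succ_pos n)
  obtain ⟨ρ₀, hρ₀, hmin⟩ :=
    hFfin.toFinset.exists_min_image (fun ρ : ℂ ↦ ρ.re) ((Finite.toFinset_nonempty hFfin).2 hFne)
  have hρ₀F : ρ₀ ∈ F := hFfin.mem_toFinset.1 hρ₀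
  set θ : ℝ := ρ₀.re - 1 / 2 with hθdef
  have hθ : 0 < θ := by
    have h1 := (hFsub hρ₀F).2.1
    simp only [hθdef]
    linarith
  have hfinθ : {ρ : ℂ | ρ ∈ riemannZetaNontrivialZeros ∧ 1 / 2 + θ ≤ ρ.re ∧ 0 < ρ.im}.Finite := by
    by_contra hinf
    exact hnone θ ⟨hθ, hinf⟩
  have hsub : F ⊆ {ρ : ℂ | ρ ∈ riemannZetaNontrivialZeros ∧ 1 / 2 + θ ≤ ρ.re ∧ 0 < ρ.im} := fun ρ hρ ↦
    ⟨(hFsub hρ).1, by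
      have h1 := hmin ρ (hFfin.mem_toFinset.2 hρ)
      simp only [hθdef]
      linarith, (hFsub hρ).2.2⟩
  have hcard : n + 1 ≤ hfinθ.toFinset.card := by
    have h1 := encard_le_encard hsub
    rw [hFcard, hfinθ.encard_eq_coe_toFinset_card] at h1
    exact_mod_cast h1
  obtain ⟨A, hA⟩ := evenNegIndexAtLeast_of_finite_above hθ hfinθ hcard
  exact hno A (hA A le_rfl)

/-- Equivalently: `n + 1` off-line quadruples and no accumulation above the line force `n + 1` independent negative
even directions on some window. [cite: Bombieri2000Weil, Thm 9 (even part)] -/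
theorem exists_evenNegIndexAtLeast_succ_of_lt_encard (n : ℕ)
    (hacc : ∀ θ : ℝ, 0 < θ → {ρ : ℂ | ρ ∈ riemannZetaNontrivialZeros ∧ 1 / 2 + θ ≤ ρ.re ∧ 0 < ρ.im}.Finite)
    (hK : (n : ℕ∞) < {ρ : ℂ | ρ ∈ riemannZetaNontrivialZeros ∧ 1 / 2 < ρ.re ∧ 0 < ρ.im}.encard) :
    ∃ a : ℝ, EvenNegIndexAtLeast (n + 1) a := by
  by_contra hno
  rw [not_exists] at hno
  rcases encard_le_or_infinite_above n hno with hle | ⟨θ, hθ, hinf⟩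
  · exact absurd hK (not_lt.2 hle)
  · exact hinf (hacc θ hθ)

/-- **The negative even index under "no accumulation above the line" (`K = ∞` allowed).**  HYPOTHESIS (H_acc):
for every `θ > 0` only finitely many non-trivial zeros have `Re ρ ≥ 1/2 + θ`, `Im ρ > 0`.  Then for EVERY `n`:
`(∃ a, EvenNegIndexAtLeast n a) ↔ n ≤ K` with `K = #𝒬 ∈ ℕ ∪ {∞}` — the even negative index on long windows is
exactly the number of off-line quadruples, finite or not.  Gen 5's `exists_evenNegIndexAtLeast_iff` is the case
`K < ∞` (where (H_acc) is automatic). [cite: Bombieri2000Weil, Thm 9 (even part); Thm 11] -/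
theorem exists_evenNegIndexAtLeast_iff_of_forall_finite_above
    (hacc : ∀ θ : ℝ, 0 < θ → {ρ : ℂ | ρ ∈ riemannZetaNontrivialZeros ∧ 1 / 2 + θ ≤ ρ.re ∧ 0 < ρ.im}.Finite)
    (n : ℕ) :
    (∃ a : ℝ, EvenNegIndexAtLeast n a) ↔
      (n : ℕ∞) ≤ {ρ : ℂ | ρ ∈ riemannZetaNontrivialZeros ∧ 1 / 2 < ρ.re ∧ 0 < ρ.im}.encard := by
  constructor
  · rintro ⟨a, ha⟩
    exact le_encard_quadrant_of_evenNegIndexAtLeast ha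
  · intro hn
    cases n with
    | zero => exact ⟨0, evenNegIndexAtLeast_zero 0⟩
    | succ k =>
      refine exists_evenNegIndexAtLeast_succ_of_lt_encard k hacc (lt_of_lt_of_le ?_ hn)
      exact_mod_cast Nat.lt_succ_self k

/-- In particular: infinitely many off-line quadruples WITHOUT accumulation above the line force an UNBOUNDED
negative even index — for every `n` some window carries `n` independent negative even directions.  (The only
`K = ∞` configuration left undecided by the even level-sign hierarchy is accumulation above the line.)
[cite: Bombieri2000Weil, Thm 11] -/
theorem forall_exists_evenNegIndexAtLeast_of_infinite
    (hacc : ∀ θ : ℝ, 0 < θ → {ρ : ℂ | ρ ∈ riemannZetaNontrivialZeros ∧ 1 / 2 + θ ≤ ρ.re ∧ 0 < ρ.im}.Finite)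
    (hinf : {ρ : ℂ | ρ ∈ riemannZetaNontrivialZeros ∧ 1 / 2 < ρ.re ∧ 0 < ρ.im}.Infinite) (n : ℕ) :
    ∃ a : ℝ, EvenNegIndexAtLeast n a :=
  (exists_evenNegIndexAtLeast_iff_of_forall_finite_above hacc n).2 (by rw [hinf.encard_eq]; exact le_top)

/-- The level-`n` statement read contrapositively with gen 4's count: a BOUNDED even index (`∃ n`, no window carries
`n + 1` negative even directions) is equivalent, absent accumulation above the line, to `K < ∞`; and then the
bound is attained: the least such `n` is `K`. Here the clean form: under (H_acc), `(∀ a, ¬ EvenNegIndexAtLeast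
(n+1) a) ↔ K ≤ n`. [cite: Bombieri2000Weil, Thm 9 (even part); Thm 11] -/
theorem forall_not_evenNegIndexAtLeast_succ_iff_of_forall_finite_above
    (hacc : ∀ θ : ℝ, 0 < θ → {ρ : ℂ | ρ ∈ riemannZetaNontrivialZeros ∧ 1 / 2 + θ ≤ ρ.re ∧ 0 < ρ.im}.Finite)
    (n : ℕ) :
    (∀ a : ℝ, ¬ EvenNegIndexAtLeast (n + 1) a) ↔
      {ρ : ℂ | ρ ∈ riemannZetaNontrivialZeros ∧ 1 / 2 < ρ.re ∧ 0 < ρ.im}.encard ≤ n := by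
  rw [← not_lt, ← not_exists, not_iff_not]
  constructor
  · rintro ⟨a, ha⟩
    have h := le_encard_quadrant_of_evenNegIndexAtLeast ha
    refine lt_of_lt_of_le ?_ h
    exact_mod_cast Nat.lt_succ_self n
  · exact exists_evenNegIndexAtLeast_succ_of_lt_encard n hacc

end Summit.RiemannHypothesis.RiemannHypothesis.Theorems.PfPersistenceM2NegIndex

end
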